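import Summits.QuantumFields.YangMills.Theorems.UnitScaleTiltProp7OneFormGreenBlockSupKFree
import Summits.QuantumFields.YangMills.Theorems.UnitScaleTiltProp7OneFormCoerciveHolds
import Summits.QuantumFields.YangMills.Theorems.UnitScaleTiltProp7KernelRow349AllMembers
import Summits.QuantumFields.YangMills.Theorems.UnitScaleTiltProp7LiftOfRSEqPrintProjector
import HarnessLib

/-!
# Route `UnitScaleTilt`, crux K1 «MinimiserStabilityRegPr» (stmt-QuantumFields-19200), EX row `h133` ∕ `norm_G` road N6, (K2)-storey of `G₀ = Δ_a(U₀)⁻¹`, family level: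
# **(Gb) FOR ALL MEMBERS WITH L-ONLY CONSTANTS** — the `hGb` letter of N6 FILE D3 `hGblk_pi_of_blockLetters` as an L-only family, from the (γ) + hk_D packages

Cell `ym3-torus` (HUMAN RULING D-0037; rung R3 = SU(2) YM₃ on T³ — NOT d = 4, NOT infinite volume, NOT a mass gap, NOT Clay).  Width seat `ym3-torus-px16` g14
(`--supports stmt-QuantumFields-19200 --as helper`).  THEOREMS ONLY (0 `def`, 0 `sorry`, default heartbeats); count-neutral.

WHAT.  ★★★ `blockSup_GT_DeltaEtaSlot_family` — the (Gb) twin of the px16 lineage's ✓`blockColumn_GT_DeltaEtaSlot_family`, token for token: for L-only weights `c₀ cB : ℕ → ℝ`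
(positive) and a coupling window `0 < a₀ ≤ a₁`, THERE ARE L-only `αG BV δG : ℕ → ℝ` (cap with the three windows of record, constant `≥ 0`, rate `> 0`) such that for every `L > 1`,
every member `i : Idx L`, every background `U₀` with `RegPr ρ U₀`, `ρ ≤ αG L`, under `Lift`, and every coupling `a₀(c₀ L∕cB L)ℓ³ ≤ a ≤ a₁(c₀ L∕cB L)ℓ³` (`ℓ = L^{K−n}` of the member):
N6 FILE D3's `hGb` TEXT at the slot `DeltaEtaSlot` —
`∀ X z, (∀ b, X b ≠ 0 → B b₋ = z) → ∀ s ≥ 0, (∀ b, ‖X b‖ ≤ s) → ∀ bd, ‖toL2⁻¹(G₀(toL2 X)) bd‖ ≤ s · BV L · e^{−δG L·tdist(B bd₋, z)}`.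
PROOF.  (γ) ⟸ ✓`hco_DeltaEtaSlot_exists` (`αco γco`); hk_D ⟸ px10 ✓`kernelRow349_allMembers_exists` (`αK CK δK`, `C_K·ℓ⁻³`, `projR`-text) read in `R_S`-text under `Lift` via
✓`exists_intertwiner_of_regPr` + ✓`RS_eq_projR_iff_lift`; then the member theorem ✓`blockSup_GT_DeltaEtaSlot_kfree` at the SAME L-only choices as ✓`blockColumn_GT_DeltaEtaSlot_family`
(`ε L := min ⅛ (γco L∕(8C_V¹))`, `r L := min (min ¼ (δK L∕2)) (min (γco L·ε L∕48) (γco L∕(16(T L + 1))))`, `αG L := min (min (αco L) (αK L)) (min (10¹⁰L⁶)⁻¹ (γco L∕(16·10⁵)))`,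
`δG L := min (r L) ¼ ∕ 2`), `BV L := C_G(γco L, CK L, δK L, a₁, r L)∕2` — so the cap `αG` and the rate `δG` COINCIDE with the `hGcol` family's (one cap serves both letters in the
K-storey knit; the witnesses are definitionally the same terms over the same two `obtain`s).
HONEST SCOPE.  An `∃`-package over two landed `∃`-packages and the member theorem; the constants are EXISTENTIAL-but-L-only (as (γ)'s `γco` is); CONDITIONAL on nothing displayed beyond
`RegPr`∕cap∕`Lift`∕coupling window; nothing of `h133`, `norm_G`, `hCk`, the EX rows, EX or the crux is proved — this is the (K2)-storey's block-sup VALUE input to the N6 ∕ (K3)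
family knit, no more; no summit is proved by a helper.

References: T. Bałaban, CMP **99** (1985) 389–434 [Balaban1985BackgroundPropagators] (Thm 3.3 (3.46)–(3.49) pp.398–399, Thm 3.11 p.416, Thm 3.12 p.423, (3.114)–(3.115) p.418);
CMP **102** (1985) 277–309 [Balaban1985Variational] (Thm 1 p.279, the `L`-only constants).
-/

set_option autoImplicit false

noncomputable section

open scoped Matrix.Norms.L2Operator BigOperators InnerProductSpace ComplexConjugate

namespace Summit.QuantumFields.YangMills.Theorems.Prop7OneFormGreenBlockSupFamily

open Literature.MathematicalPhysics.QuantumFieldTheory.Balaban1983to89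
open Literature.MathematicalPhysics.QuantumFieldTheory.Balaban1983to89.T3ContinuumYM3Torus
open Literature.MathematicalPhysics.QuantumFieldTheory.Balaban1983to89.T3PrintedRegularMinimiser (RegPr)
open Literature.MathematicalPhysics.QuantumFieldTheory.Balaban1983to89.T3PrintedMinimiserExistence (regPr_mono)
open B15DeterminingSets (embIter)
open T3SectALandauChart (formComp bgUnits eta eta_pos)
open B9SectCLatticeCarrier (Bond)
open B9Eq311L2Pairing (WL2)
open B11Eq103H1Complex (BondL2K projR)
open B5Eq118OneStroke (iterBlockOf)
open Summit.QuantumFields.YangMills.Theorems.Prop8Chart (emlIterU)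
open Summit.QuantumFields.YangMills.Theorems.Prop7SectET3Transport (periodsT3 bondEquiv)
open Summit.QuantumFields.YangMills.Theorems.Prop7SectET3HilbertLetters (W₂ frobEquiv toL2 toL2S DL2 DstarL2 covLapSite)
open Summit.QuantumFields.YangMills.Theorems.Prop7SectET3WilsonHessian (DeltaEtaSlot)
open Summit.QuantumFields.YangMills.Theorems.Prop7SectET3GaugeProjector (RS)
open Summit.QuantumFields.YangMills.Theorems.Prop7SectET3CurvedPropagators (laplaceA Qk GT PosOnto)
open Summit.QuantumFields.YangMills.Theorems.Prop7OneFormCoerciveHolds (hco_DeltaEtaSlot_exists)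
open Summit.QuantumFields.YangMills.Theorems.Prop7KernelRow349AllMembers (kernelRow349_allMembers_exists)
open Summit.QuantumFields.YangMills.Theorems.Prop7LiftOfRSEqPrintProjector (RS_eq_projR_iff_lift)
open Summit.QuantumFields.YangMills.Theorems.Prop7NSIntertwinerOfRecord (exists_intertwiner_of_regPr)
open Summit.QuantumFields.YangMills.Theorems.Prop7OneFormGreenBlockSupKFree (blockSup_GT_DeltaEtaSlot_kfree)

/-- ★★★ **THE `hGb` FAMILY: THE BLOCK-SUPPORTED DECAYED SUP ROW OF `G₀` FOR ALL MEMBERS, L-ONLY CONSTANTS.**  For positive L-only weights `c₀ cB` and a coupling window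
`0 < a₀ ≤ a₁` there are `αG BV δG : ℕ → ℝ` with `0 < αG L`, `10¹²L³αG L ≤ 1`, `10¹⁰L⁶αG L ≤ 1`, `13·10¹⁴L³αG L ≤ 1`, `0 ≤ BV L`, `0 < δG L`, and: for every `L > 1`, member
`i : Idx L`, background `U₀` with `RegPr ρ U₀`, `ρ ≤ αG L`, under `Lift`, and coupling `a₀(c₀ L∕cB L)ℓ³ ≤ a ≤ a₁(c₀ L∕cB L)ℓ³`:
`∀ X z, (∀ b, X b ≠ 0 → B b₋ = z) → ∀ s ≥ 0, (∀ b, ‖X b‖ ≤ s) → ∀ bd, ‖toL2⁻¹(G₀(toL2 X)) bd‖ ≤ s·BV L·e^{−δG L·tdist(B bd₋, z)}`, `G₀ = GT … a (DeltaEtaSlot …) U₀`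
(print's (3.46)∕(3.49) `O(1)` decayed block row, uniform in `K`). [cite: Balaban1985BackgroundPropagators, Thm 3.3 (3.46)–(3.49) pp.398–399, Thm 3.11 p.416, Thm 3.12 p.423;
Balaban1985Variational, Thm 1 p.279] -/
theorem blockSup_GT_DeltaEtaSlot_family (c₀ cB : ℕ → ℝ) [hc₀ : ∀ L : ℕ, Fact (0 < c₀ L)] [hcB : ∀ L : ℕ, Fact (0 < cB L)] {a₀ a₁ : ℝ} (ha₀ : 0 < a₀) (ha₀₁ : a₀ ≤ a₁) :
    ∃ (αG BV δG : ℕ → ℝ),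
      (∀ L : ℕ, 1 < L → 0 < αG L) ∧ (∀ L : ℕ, 1 < L → 10 ^ 12 * (L : ℝ) ^ 3 * αG L ≤ 1) ∧ (∀ L : ℕ, 1 < L → 10 ^ 10 * (L : ℝ) ^ 6 * αG L ≤ 1) ∧
      (∀ L : ℕ, 1 < L → 13 * 10 ^ 14 * (L : ℝ) ^ 3 * αG L ≤ 1) ∧ (∀ L : ℕ, 1 < L → 0 ≤ BV L) ∧ (∀ L : ℕ, 1 < L → 0 < δG L) ∧
    ∀ (L : ℕ), 1 < L → ∀ (i : T3Thm1Carrier.Idx L) (U₀ : GaugeField (i.1.1.P i.1.2.2) 0 (Matrix.specialUnitaryGroup (Fin 2) ℂ)), ∀ ρ : ℝ, RegPr i.1.1 i.1.2.1 i.1.2.2 ρ U₀ → ρ ≤ αG L →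
        (∀ cf : Site (i.1.1.P i.1.2.2) (i.1.2.2 - i.1.2.1) → Matrix (Fin 2) (Fin 2) ℂ,
        (∀ e' : PBond (i.1.1.P i.1.2.2) (i.1.2.2 - i.1.2.1), cf e'.src = ((emlIterU (i.1.2.2 - i.1.2.1) (bgUnits i.1.1 i.1.2.2 U₀) e' : (Matrix (Fin 2) (Fin 2) ℂ)ˣ) : Matrix (Fin 2) (Fin 2) ℂ) * cf e'.tgt *
        (((emlIterU (i.1.2.2 - i.1.2.1) (bgUnits i.1.1 i.1.2.2 U₀) e')⁻¹ : (Matrix (Fin 2) (Fin 2) ℂ)ˣ) : Matrix (Fin 2) (Fin 2) ℂ)) →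
        ∃ l₀ : Site (i.1.1.P i.1.2.2) 0 → Matrix (Fin 2) (Fin 2) ℂ,
        (∀ b' : PBond (i.1.1.P i.1.2.2) 0, l₀ b'.src = ((bgUnits i.1.1 i.1.2.2 U₀ b' : (Matrix (Fin 2) (Fin 2) ℂ)ˣ) : Matrix (Fin 2) (Fin 2) ℂ) * l₀ b'.tgt * (((bgUnits i.1.1 i.1.2.2 U₀ b')⁻¹ : (Matrix (Fin 2) (Fin 2) ℂ)ˣ) : Matrix (Fin 2) (Fin 2) ℂ)) ∧
        ∀ y : Site (i.1.1.P i.1.2.2) (i.1.2.2 - i.1.2.1), l₀ (embIter (i.1.2.2 - i.1.2.1) y) = cf y) →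
      ∀ a : ℝ, a₀ * (c₀ L / cB L) * ((i.1.1.L : ℝ) ^ (i.1.2.2 - i.1.2.1)) ^ 3 ≤ a → a ≤ a₁ * (c₀ L / cB L) * ((i.1.1.L : ℝ) ^ (i.1.2.2 - i.1.2.1)) ^ 3 →
      ∀ (X : PBond (i.1.1.P i.1.2.2) 0 → Matrix (Fin 2) (Fin 2) ℂ) (z : Site (i.1.1.P i.1.2.2) (i.1.2.2 - i.1.2.1)),
        (∀ b, X b ≠ 0 → iterBlockOf (i.1.2.2 - i.1.2.1) b.src = z) → ∀ s : ℝ, 0 ≤ s → (∀ b, ‖X b‖ ≤ s) →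
          ∀ bd : PBond (i.1.1.P i.1.2.2) 0,
            ‖(toL2 i.1.1 i.1.2.2 (c₀ L)).symm (GT i.1.1 i.1.2.1 i.1.2.2 i.2.2.le (c₀ L) (cB L) a (DeltaEtaSlot i.1.1 i.1.2.1 i.1.2.2 (c₀ L)) U₀
                (toL2 i.1.1 i.1.2.2 (c₀ L) X)) bd‖
              ≤ s * BV L * Real.exp (-(δG L * (Site.tdist (P := i.1.1.P i.1.2.2) (iterBlockOf (i.1.2.2 - i.1.2.1) bd.src) z : ℝ))) := by
  obtain ⟨αco, γco, hαco, hWco, hwinco, hγco, hco⟩ := hco_DeltaEtaSlot_exists c₀ cB ha₀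
  obtain ⟨αK, CK, δK, hαK, hWK, hCK, hδK, hkD⟩ := kernelRow349_allMembers_exists c₀ cB
  -- the L-only choices
  set CV1 : ℝ := 32 * Real.sqrt 2 * 648 + (33 / 8 : ℝ) ^ 2 * (600 * (27 / 4 : ℝ) ^ 6) with hCV1
  have hCV1pos : 0 < CV1 := by rw [hCV1]; positivity
  have ha₁ : 0 ≤ a₁ := le_trans ha₀.le ha₀₁
  set T : ℕ → ℝ := fun L => 5000 * a₁ + 27 * Real.sqrt 2 * CK L * (2 * (1 + 4 / δK L)) ^ 3 / min 1 (δK L / 4) with hT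
  set ε : ℕ → ℝ := fun L => min (1 / 8) (γco L / (8 * CV1)) with hε
  set r : ℕ → ℝ := fun L => min (min (1 / 4) (δK L / 2)) (min (γco L * ε L / 48) (γco L / (16 * (T L + 1)))) with hr
  set αG : ℕ → ℝ := fun L => min (min (αco L) (αK L)) (min ((10 ^ 10 * (L : ℝ) ^ 6)⁻¹) (γco L / (16 * 10 ^ 5))) with hαG
  have hT0 : ∀ L, 1 < L → 0 ≤ T L := fun L hL => by
    have := hCK L hL; have := hδK L hL
    simp only [hT]; positivity
  have hε0 : ∀ L, 1 < L → 0 < ε L := fun L hL => by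
    have := hγco L hL; simp only [hε]; exact lt_min (by norm_num) (by positivity)
  have hr0 : ∀ L, 1 < L → 0 < r L := fun L hL => by
    have := hγco L hL; have := hδK L hL; have := hε0 L hL; have := hT0 L hL
    simp only [hr]; exact lt_min (lt_min (by norm_num) (by positivity)) (lt_min (by positivity) (by positivity))
  have hαG0 : ∀ L, 1 < L → 0 < αG L := fun L hL => by
    have := hγco L hL; have := hαco L hL; have := hαK L hL
    have hL0 : (0 : ℝ) < L := by exact_mod_cast lt_trans zero_lt_one hL
    simp only [hαG]; exact lt_min (lt_min (by assumption) (by assumption)) (lt_min (by positivity) (by positivity))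
  refine ⟨αG,
    fun L => 2 * ((Real.sqrt 2 + Real.sqrt 2 * ((50 * a₁ * Real.exp (δK L) + CK L) * (3 * Real.sqrt 2) * (Real.exp (6 * r L) * (2 / γco L)) * (2 * (1 + 2 / δK L)) ^ 3))
        * (8 * Real.exp (3 * r L)) * 14
      + 36 * (Real.sqrt (8 * Real.exp (3 * r L) * (2 * (1 + 1 / r L)) ^ 3) * (Real.exp (6 * r L) * (2 / γco L)))),
    fun L => min (r L) (1 / 4) / 2, hαG0, fun L hL => ?_, fun L hL => ?_, fun L hL => ?_, fun L hL => ?_, fun L hL => ?_, ?_⟩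
  · -- window `10¹²L³`
    have h1 : αG L ≤ αco L := by simp only [hαG]; exact (min_le_left _ _).trans (min_le_left _ _)
    have hL0 : (0 : ℝ) < L := by exact_mod_cast lt_trans zero_lt_one hL
    exact (mul_le_mul_of_nonneg_left h1 (by positivity)).trans (hWco L hL)
  · -- window `10¹⁰L⁶`
    have hL0 : (0 : ℝ) < L := by exact_mod_cast lt_trans zero_lt_one hL
    have h1 : αG L ≤ (10 ^ 10 * (L : ℝ) ^ 6)⁻¹ := by simp only [hαG]; exact (min_le_right _ _).trans (min_le_left _ _)
    calc 10 ^ 10 * (L : ℝ) ^ 6 * αG L ≤ 10 ^ 10 * (L : ℝ) ^ 6 * (10 ^ 10 * (L : ℝ) ^ 6)⁻¹ := mul_le_mul_of_nonneg_left h1 (by positivity)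
      _ = 1 := mul_inv_cancel₀ (by positivity)
  · -- window `13·10¹⁴L³`
    have h1 : αG L ≤ αco L := by simp only [hαG]; exact (min_le_left _ _).trans (min_le_left _ _)
    have hL0 : (0 : ℝ) < L := by exact_mod_cast lt_trans zero_lt_one hL
    exact (mul_le_mul_of_nonneg_left h1 (by positivity)).trans (hwinco L hL)
  · -- `0 ≤ BV L`
    have := hγco L hL; have := hCK L hL; have := hδK L hL; have := hr0 L hL
    positivity
  · -- `0 < δG L`
    have := hr0 L hL
    exact div_pos (lt_min this (by norm_num)) two_pos
  -- the member
  intro L hL i U₀ ρ hreg hρ hlift a ha₀a ha₁a X z hXz s hs hX bd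
  have hγ := hγco L hL
  have hCKL := hCK L hL
  have hδKL := hδK L hL
  have hεL := hε0 L hL
  have hrL := hr0 L hL
  have hTL := hT0 L hL
  have hαL := hαG0 L hL
  have hc₀L : 0 < c₀ L := (hc₀ L).out
  have hcBL : 0 < cB L := (hcB L).out
  have hL0 : (0 : ℝ) < L := by exact_mod_cast lt_trans zero_lt_one hL
  have hLL : (L : ℝ) = (i.1.1.L : ℝ) := by rw [i.2.1]
  -- the cap and its windows at this member (`F.L = L`)
  have hαco' : αG L ≤ αco L := by simp only [hαG]; exact (min_le_left _ _).trans (min_le_left _ _)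
  have hαK' : αG L ≤ αK L := by simp only [hαG]; exact (min_le_left _ _).trans (min_le_right _ _)
  have hαγ' : αG L ≤ γco L / (16 * 10 ^ 5) := by simp only [hαG]; exact (min_le_right _ _).trans (min_le_right _ _)
  have hW1 : 10 ^ 12 * (i.1.1.L : ℝ) ^ 3 * αG L ≤ 1 := by
    rw [← hLL]; exact (mul_le_mul_of_nonneg_left hαco' (by positivity)).trans (hWco L hL)
  have hW2 : 10 ^ 10 * (i.1.1.L : ℝ) ^ 6 * αG L ≤ 1 := by
    rw [← hLL]
    have h1 : αG L ≤ (10 ^ 10 * (L : ℝ) ^ 6)⁻¹ := by simp only [hαG]; exact (min_le_right _ _).trans (min_le_left _ _)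
    calc 10 ^ 10 * (L : ℝ) ^ 6 * αG L ≤ 10 ^ 10 * (L : ℝ) ^ 6 * (10 ^ 10 * (L : ℝ) ^ 6)⁻¹ := mul_le_mul_of_nonneg_left h1 (by positivity)
      _ = 1 := mul_inv_cancel₀ (by positivity)
  have hW3 : 13 * 10 ^ 14 * (i.1.1.L : ℝ) ^ 3 * αG L ≤ 1 := by
    rw [← hLL]; exact (mul_le_mul_of_nonneg_left hαco' (by positivity)).trans (hwinco L hL)
  have hregG : RegPr i.1.1 i.1.2.1 i.1.2.2 (αG L) U₀ := regPr_mono i.1.1 hρ hreg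
  have hregK : RegPr i.1.1 i.1.2.1 i.1.2.2 (αK L) U₀ := regPr_mono i.1.1 (hρ.trans hαK') hreg
  -- (γ) at this member
  have hco' := hco L hL i U₀ ρ hreg (hρ.trans hαco') hlift a ha₀a
  -- hk_D at this member, in `R_S`-text under `Lift`
  obtain ⟨Q'', D', hint, hD', htop, hseq, hker⟩ :=
    exists_intertwiner_of_regPr i.1.1 i.2.2.le (c₀ := c₀ L) (cB L) hαL hW1 U₀ hregG
  have hRS : RS i.1.1 i.1.2.1 i.1.2.2 i.2.2.le (c₀ L) (cB L) U₀ = projR (covLapSite i.1.1 i.1.2.1 i.1.2.2 (c₀ L) U₀) Q'' :=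
    (RS_eq_projR_iff_lift i.1.1 i.2.2.le (cB L) hαL hW1 U₀ hregG Q'' htop hker).2 hlift
  have hkD' := hkD L hL i U₀ hregK Q'' htop hker
  rw [← hRS, hLL] at hkD'
  -- the coupling window gives `0 ≤ a`
  have ha : 0 ≤ a := le_trans (by positivity) ha₀a
  -- the budgets
  have hε8 : ε L ≤ 1 / 8 := by simp only [hε]; exact min_le_left _ _
  have hεC : ε L * CV1 ≤ γco L / 8 := by
    have h1 : ε L ≤ γco L / (8 * CV1) := by simp only [hε]; exact min_le_right _ _
    calc ε L * CV1 ≤ γco L / (8 * CV1) * CV1 := mul_le_mul_of_nonneg_right h1 hCV1pos.le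
      _ = γco L / 8 := by field_simp
  have hr4 : r L ≤ 1 / 4 := by simp only [hr]; exact (min_le_left _ _).trans (min_le_left _ _)
  have hrδ : r L ≤ δK L / 2 := by simp only [hr]; exact (min_le_left _ _).trans (min_le_right _ _)
  have hrγ : r L ≤ γco L * ε L / 48 := by simp only [hr]; exact (min_le_right _ _).trans (min_le_left _ _)
  have hrT : r L * T L ≤ γco L / 16 := by
    have h1 : r L ≤ γco L / (16 * (T L + 1)) := by simp only [hr]; exact (min_le_right _ _).trans (min_le_right _ _)
    calc r L * T L ≤ r L * (T L + 1) := mul_le_mul_of_nonneg_left (by linarith) hrL.le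
      _ ≤ γco L / (16 * (T L + 1)) * (T L + 1) := mul_le_mul_of_nonneg_right h1 (by linarith)
      _ = γco L / 16 := by field_simp
  have hαγ : 10 ^ 5 * αG L ≤ γco L / 16 := by
    calc 10 ^ 5 * αG L ≤ 10 ^ 5 * (γco L / (16 * 10 ^ 5)) := mul_le_mul_of_nonneg_left hαγ' (by positivity)
      _ = γco L / 16 := by field_simp
  have hmain := blockSup_GT_DeltaEtaSlot_kfree i.1.1 i.2.2.le (c₀ L) (cB L) i.2.2 hαL hW1 hW2 hW3 U₀ hregG hlift ha ha₁a hγ hco' hCKL hδKL hkD'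
    hrL hr4 hrδ hεL hε8 hεC hrγ (by simp only [hT] at hrT; exact hrT) hαγ X z hXz s hs hX bd
  exact hmain

end Summit.QuantumFields.YangMills.Theorems.Prop7OneFormGreenBlockSupFamily

end
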